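import Summits.AnomalousDissipation.AnomalousDissipation.Theorems.SolenoidalFractalHomogenisationRealisedQuasiStaticCellLawWeakSectorDecayRates
import Summits.AnomalousDissipation.AnomalousDissipation.Theorems.SolenoidalFractalHomogenisationRealisedQuasiStaticCellLawWeakFarSlotAlgebra
import Summits.AnomalousDissipation.AnomalousDissipation.Theorems.SolenoidalFractalHomogenisationRealisedQuasiStaticCellLawCellSlotFormulas
import Summits.AnomalousDissipation.AnomalousDissipation.Theorems.SolenoidalFractalHomogenisationRealisedQuasiStaticCellLawWeakFarScalars
import HarnessLib

/-!
# K2R `RealisedQuasiStaticCellLaw`, line `floquet-bloch`, stub `stub_lowSectorWeakFar`: the W-far road at the replayed cell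
# word (helper; `--supports stmt-AnomalousDissipation-20446`)

Summits-side helper file (everything proved; no definitions, no named facts). `weakSector_decay_of_rates` instantiated at
`W′ = (cubatureWord.stretch M).stretch (1/ν)`, `κ = ν/n²`, weights `ε = 1/16`, `β = 74`, for a sector representative `ℓ`
with `|ℓ|² ≥ 4` and `‖ℓ‖ ≤ (δ/10⁴)·nν` (weak coupling): the scalar smallness conditions hold for `M ≥ 10`, `ν ≤ 1`, and
the rate inequality `8π²·3720·M(1 + (1−δ)c_W/ν²)/n² ≤ Σ_j m_j` follows from the min-polarisation cubature identity
`Σ_j (slotTerm_j(ℓ,0) − slotTerm_j(ℓ,ℓ)) = (1/3)c0·3720|ℓ|⁴` and the in-plane defect bound (`weakFar_decay_at_cell`).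
-/

set_option linter.dupNamespace false

noncomputable section

namespace Summit.AnomalousDissipation.AnomalousDissipation.Theorems.SolenoidalFractalHomogenisation.RealisedQuasiStaticCellLaw

open Set MeasureTheory Filter Topology Function Matrix
open scoped InnerProductSpace ComplexConjugate Matrix
open Literature.Analysis Literature.Analysis.FunctionSpaces Literature.Analysis.FunctionSpaces.Torus
open Literature.Analysis.FluidPDE Literature.Analysis.FluidPDE.LatticeShear

/-- **The W-far road at the cell word.** -/
theorem weakFar_decay_at_cell {δ M ν : ℝ} (hδ : 0 < δ) (hδ1 : δ ≤ 1) (hM : 0 < M) (hM10 : 10 ≤ M)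
    (hν : 0 < ν) (hν1 : ν ≤ 1) {n : ℕ}
    (hKn : 8 * Real.pi ^ 2 * 3720 * M * (1 + (1 - 4 * cubatureWord.ramp / 3) * c0) + 300 ≤ (n : ℝ) * ν)
    (ℓ : Fin 3 → ℤ) (hℓ : ℓ ≠ 0) (hℓ4 : 4 ≤ freqNormSq ℓ)
    (hsmall : ‖latticeVec ℓ‖ ≤ δ / 10000 * ((n : ℝ) * ν))
    {w₀ : UnitAddTorus (Fin 3) → EuclideanSpace ℝ (Fin 3)}
    (hw₀ : FunctionSpaces.Torus.MemSobolev 1 (FunctionSpaces.EuclideanSpace.complexify ∘ w₀))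
    (hdiv : FunctionSpaces.Torus.IsWeaklyDivFree w₀) (hmean : FunctionSpaces.Torus.HasZeroMean w₀)
    (hsupp : ∀ k : Fin 3 → ℤ, ¬ ((∃ z : Fin 3 → ℤ, k = ℓ + (n:ℤ) • z) ∨ (∃ z : Fin 3 → ℤ, k = -ℓ + (n:ℤ) • z)) →
      UnitAddTorus.mFourierCoeff (FunctionSpaces.EuclideanSpace.complexify ∘ w₀) k = 0)
    {T : ℝ} (hT : 0 < T) {w : ℝ → UnitAddTorus (Fin 3) → EuclideanSpace ℝ (Fin 3)}
    (hw : Torus.IsWeakPassiveVectorOn 0 T (ν / (n : ℝ) ^ 2)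
      (((cubatureWord.stretch M hM).stretch (1 / ν) (one_div_pos.mpr hν)).cell n) w₀ w) :
    ∀ᵐ t ∂(volume.restrict (Ioo 0 T)), ∫ x, ‖w t x‖ ^ 2 ≤
      ((8 * Real.pi ^ 2 * 3720 * M * (1 + (1 - 4 * cubatureWord.ramp / 3) * c0) + 300) / ν) *
        Real.exp (-(8 * Real.pi ^ 2 * (1 + (1 - δ) * ((1 - 4 * cubatureWord.ramp / 3) * c0) / ν ^ 2) * ν /
          (n : ℝ) ^ 2) * t) * ∫ x, ‖w₀ x‖ ^ 2 := by
  classical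
  obtain ⟨W', hW'⟩ : ∃ W' : LatticeWord 26, W' = (cubatureWord.stretch M hM).stretch (1 / ν) (one_div_pos.mpr hν) :=
    ⟨_, rfl⟩
  rw [← hW'] at hw
  have hπ := Real.pi_gt_three
  have hc0p := c0_pos
  have hρ : cubatureWord.ramp = 1 / 2 := (cubature_phase_fields 0).2.2.2
  have hcc : c0 = 7 / (4960 * Real.pi ^ 4) := rfl
  have hcW : 0 < (1 - 4 * cubatureWord.ramp / 3) * c0 := by rw [hρ]; positivity
  have hnν : 300 ≤ (n : ℝ) * ν := by
    have : 0 ≤ 8 * Real.pi ^ 2 * 3720 * M * (1 + (1 - 4 * cubatureWord.ramp / 3) * c0) := by positivity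
    linarith
  have hn : 0 < n := Nat.pos_of_ne_zero (by rintro rfl; norm_num at hnν)
  have hn' : (0 : ℝ) < n := by exact_mod_cast hn
  have hκ : 0 < ν / (n : ℝ) ^ 2 := by positivity
  -- the slot constants of `W'`
  have hcs := fun j => cellSlot_formulas cubatureWord hM hν hn j ℓ
  have hfm : ∀ j, (W'.phase j).m = (cubatureWord.phase j).m := fun j => by rw [hW']; exact (hcs j).1
  have hfe : ∀ j, (W'.phase j).e = (cubatureWord.phase j).e := fun j => by rw [hW']; exact (hcs j).2.1
  have hfφ : ∀ j, (W'.phase j).φ = (cubatureWord.phase j).φ := fun j => by rw [hW']; exact (hcs j).2.2.1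
  have hfτ : ∀ j, (W'.phase j).τ = M * (cubatureWord.phase j).τ / ν := fun j => by
    rw [hW']; exact (hcs j).2.2.2.1
  have hframp : W'.ramp = cubatureWord.ramp := by rw [hW']; exact (hcs 0).2.2.2.2.1
  have hfP : W'.period = M * 3720 / ν := by rw [hW', (hcs 0).2.2.2.2.2.1, period_cubatureWord]
  have hΛ := fun j => (hcs j).2.2.2.2.2.2.1
  have hg := fun j => (hcs j).2.2.2.2.2.2.2.2.1
  have hTj := fun j => (hcs j).2.2.2.2.2.2.2.2.2
  clear hcs
  have hslot := fun j => cubature_slot_bounds j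
  -- sector data
  have ha1 : 1 ≤ ‖latticeVec ℓ‖ := one_le_norm_latticeVec hℓ
  have hA : freqNormSq ℓ = ‖latticeVec ℓ‖ ^ 2 := (norm_latticeVec_sq ℓ).symm
  have ha2 : 2 ≤ ‖latticeVec ℓ‖ := by nlinarith [norm_nonneg (latticeVec ℓ)]
  have han : 10000 * ‖latticeVec ℓ‖ ≤ (n : ℝ) * ν := by
    have h1 : δ / 10000 * ((n : ℝ) * ν) ≤ 1 / 10000 * ((n : ℝ) * ν) :=
      mul_le_mul_of_nonneg_right (by linarith) (by positivity)
    linarith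
  have han' : 10000 * ‖latticeVec ℓ‖ ≤ (n : ℝ) := by
    have : (n : ℝ) * ν ≤ n := mul_le_of_le_one_right hn'.le hν1
    linarith
  have hℓn : 2 * ‖latticeVec ℓ‖ ≤ n := by linarith
  have h4 : ∀ j : Fin 26, 4 * ‖latticeVec ℓ‖ ≤ ‖latticeVec (fun i => (W'.phase j).m i * (n : ℤ))‖ := by
    intro j
    rw [hfm j, (dot_cast_cellFreq ℓ _ n).2]
    have := (hslot j).2.2.2.1
    nlinarith
  have hQ : (latticeVec ℓ) 0 ^ 2 + (latticeVec ℓ) 1 ^ 2 + (latticeVec ℓ) 2 ^ 2 = freqNormSq ℓ := by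
    rw [(freqNormSq_coords ℓ).1]; simp only [latticeVec_apply]
  have hgs : ∀ j : Fin 26, ((∑ i, (cubatureWord.phase j).e i * (ℓ i : ℝ)) /
      (8 * Real.pi ^ 2 * freqNormSq (cubatureWord.phase j).m * ‖latticeVec (cubatureWord.phase j).m‖ * n * ν)) ^ 2 ≤
      1 / 10 ^ 10 := fun j =>
    far_coupling_sq_small (coupling_abs_le _ ℓ) (hslot j).1 (hslot j).2.2.2.1 hn' hν han
  -- the target exponent
  obtain ⟨c, hc⟩ : ∃ c : ℝ, c = 8 * Real.pi ^ 2 * 3720 * M *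
      (1 + (1 - δ) * ((1 - 4 * cubatureWord.ramp / 3) * c0) / ν ^ 2) / (n : ℝ) ^ 2 := ⟨_, rfl⟩
  have hc0' : 0 ≤ c := by
    rw [hc]
    have : 0 ≤ (1 - δ) * ((1 - 4 * cubatureWord.ramp / 3) * c0) / ν ^ 2 :=
      div_nonneg (mul_nonneg (by linarith) hcW.le) (by positivity)
    positivity
  have main : ∀ᵐ t ∂(volume.restrict (Ioo 0 T)), ∫ x, ‖w t x‖ ^ 2 ≤
      74 * Real.exp c * Real.exp (-(c / W'.period) * t) * ∫ x, ‖w₀ x‖ ^ 2 := by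
    refine weakSector_decay_of_rates W' hn hκ ℓ hℓ hℓn hw₀ hdiv hmean hsupp h4 (ε := 1 / 16) (β := 74)
      (by norm_num) (by norm_num) (by norm_num) (by norm_num) ?_ ?_ ?_ hc0' ?_ hT hw
    · intro j
      rw [hfm j, hfe j, hfφ j, hg j]
      exact (hgs j).trans (by norm_num)
    · intro j
      rw [hframp, hfm j, hfe j, hfφ j, hg j]
      exact far_slack_one (sq_nonneg _) (hgs j) hρ
    · intro j
      rw [hframp, hfm j, hfτ j, hTj j]
      exact far_slack_two (hslot j).1 hM10 (hslot j).2.2.2.2 hρ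
    · rw [hframp]
      obtain ⟨H, hH⟩ : ∃ H : Fin 26 → ℝ, H = fun j =>
          8 * Real.pi ^ 2 * M * freqNormSq ℓ / (n : ℝ) ^ 2 * (cubatureWord.phase j).τ +
            2 * (2 * (1 - 2 * (1 / 16)) * (1 - 4 * cubatureWord.ramp / 3) *
                (2 * Real.pi ^ 2 * M / (ν ^ 2 * (n : ℝ) ^ 2))) / freqNormSq ℓ *
              (slotTerm (slots j) (latticeVec ℓ) 0 - slotTerm (slots j) (latticeVec ℓ) (latticeVec ℓ)) -
            2 * (1 - 2 * (1 / 16)) * (1 - 4 * cubatureWord.ramp / 3) * (2 * Real.pi ^ 2 * M / (ν ^ 2 * (n : ℝ) ^ 2)) *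
              (12 * ‖latticeVec ℓ‖ / (n : ℝ)) * slotTerm (slots j) (latticeVec ℓ) 0 := ⟨_, rfl⟩
      refine le_trans ?_ (Finset.sum_le_sum (f := H) fun j _ => ?_)
      · -- the summed linear form dominates the target
        have hτsum : ∑ j, (cubatureWord.phase j).τ = 3720 := period_cubatureWord
        have hS0 : ∑ j, slotTerm (slots j) (latticeVec ℓ) 0 = 280 * freqNormSq ℓ / (32 * Real.pi ^ 4) := by
          rw [slotTerm_sum, hQ]
          simp only [PiLp.zero_apply]
          ring
        rw [hH, Finset.sum_sub_distrib, Finset.sum_add_distrib]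
        simp only [← Finset.mul_sum]
        rw [hτsum, minPol_slotTerm_sum, hQ, hS0, hc]
        exact far_rate_sum hM hν hn' ha2 hA han' hδ.le hρ hcc
      · -- per slot
        rw [hfm j, hfe j, hfφ j, hfτ j, hg j, hΛ j, freqNormSq_cellFreq, hH]
        have hpol := slotTerm_polar (slots j) (latticeVec ℓ)
        rw [← (freqNormSq_coords (slots j).m).1] at hpol
        have hsle := slotTerm_zero_le j (latticeVec ℓ)
        rw [hQ] at hsle
        have hCS := (dot_cast_facts ℓ (fun i => (cubatureWord.phase j).m i * (n : ℤ))).2.2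
        rw [(dot_cast_cellFreq ℓ _ n).2] at hCS
        exact farSlot_lower hM hν hν1 hn' ha2 hA han (hslot j).1 (hslot j).2.2.2.1 (hslot j).2.2.1
          (cubatureWord.phase j).τ_pos (cubature_coupling_sq j ℓ) (slotTerm_zero_nonneg j _) hsle hpol
          (dot_cast_facts ℓ ℓ).1 (dot_cast_cellFreq ℓ (cubatureWord.phase j).m n).1
          (by rw [(dot_cast_facts (fun i => (cubatureWord.phase j).m i * (n : ℤ)) ℓ).1, (dot_cast_cellFreq ℓ _ n).2]) hCS hρ
  -- prefactor and rate
  have hpref := far_prefactor hM hν hν1 hn' hδ.le hcW hKn hc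
  have hrate : c / W'.period = 8 * Real.pi ^ 2 * (1 + (1 - δ) * ((1 - 4 * cubatureWord.ramp / 3) * c0) / ν ^ 2) * ν /
      (n : ℝ) ^ 2 := by
    rw [hfP, hc]
    field_simp
  have hX : 0 ≤ ∫ x, ‖w₀ x‖ ^ 2 := integral_nonneg fun x => by positivity
  have hK0 : 0 ≤ (8 * Real.pi ^ 2 * 3720 * M * (1 + (1 - 4 * cubatureWord.ramp / 3) * c0) + 300) / ν :=
    le_trans (by positivity) hpref.2
  filter_upwards [main, ae_restrict_mem measurableSet_Ioo] with t ht htI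
  refine ht.trans ?_
  rw [hrate]
  exact decay_form_mono hpref.2 hK0 le_rfl htI.1.le hX

end Summit.AnomalousDissipation.AnomalousDissipation.Theorems.SolenoidalFractalHomogenisation.RealisedQuasiStaticCellLaw

end
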